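import Summits.Parity.BatemanHorn.Theorems.SelbergDelangeRigidityLSDRealSegmentTailsTwoSlice
import Literature.NumberTheory.DiophantineApproximation.SPartPolynomialValues
import Mathlib.Analysis.SpecialFunctions.Pow.Asymptotics
import HarnessLib

/-!
# Route `SelbergDelangeRigidity`, crux `LSDRealSegment` (stmt-Parity-9770), line
# `product-anatomy-subcritical`: the `p`-adic Roth input for the sparse slices (`stub_tailsTwo`)

THE PLACE WHERE (R) ENTERS.  In the small-prime restoration of `stub_tailsTwo` the slices `s` with
`lcm(s) > X^{1−θ}` (huge `P`-smooth parts of the values, e.g. `2^ν ∣ n² + 7` with `2^ν ≈ x^{1.2}`, or `n ≈ 2^a`,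
`n + 2 ≈ 3^b` for a linear pair) are NOT reached by Nair–Tenenbaum; they are SPARSE: by Bugeaud–Evertse–Győry 2018,
Thm 2.1 (i) (`Literature.NumberTheory.DiophantineApproximation.BugeaudEvertseGyory2018_SPartPolynomialValues`, the
`p`-adic Thue–Siegel–Roth theorem) the `P`-smooth part of `∏ fᵢ(n)` (total degree `2`, no multiple zeros) is
`≤ C n^{1+2ε}` (`tailsTwo_smoothPart_prodVal_le`, registered helper), so its tilt is `≤ n^{log₂ y (1+2ε)}` with
`log₂ y < 1`; each such slice holds `≪ X^θ` members of a block and there are only `(log X)^{O(1)}` slices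
(`card_smooth_le`: few smooth numbers).  This file: these ingredients (the companion `…TailsTwoSparse` sums them).
-/

open Filter Finset Polynomial
open scoped BigOperators Topology Classical

namespace Summit.Parity.BatemanHorn.Cruxes.LSDRealSegment.ProductAnatomySubcritical

open Literature.NumberTheory.Sieve
open Literature.NumberTheory.DiophantineApproximation
open ArithmeticFunction (cardFactors)
noncomputable section

variable {k : ℕ}

/-! ### Few smooth numbers -/

/-- **Few smooth numbers**: the `P`-smooth numbers in `[1, N]` number at most `(log₂ N + 1)^{π(P)}`
(induction on `P`: a `P`-smooth number is `P^a · m'`, `a ≤ log₂ N`, `m'` `(P−1)`-smooth). [folklore] -/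
theorem card_smooth_le (N : ℕ) : ∀ P : ℕ,
    #((Icc 1 N).filter fun m : ℕ => ∀ p ∈ m.primeFactors, p ≤ P) ≤ (Nat.log 2 N + 1) ^ (Nat.primesLE P).card := by
  intro P
  induction P with
  | zero =>
    rw [Nat.primesLE_zero, Finset.card_empty, pow_zero]
    refine (Finset.card_le_one_iff_subset_singleton.mpr ⟨1, fun m hm => ?_⟩)
    rw [Finset.mem_filter, Finset.mem_Icc] at hm
    rw [Finset.mem_singleton]
    by_contra h1
    obtain ⟨p, hp, hpm⟩ := Nat.exists_prime_and_dvd h1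
    have := hm.2 p (Nat.mem_primeFactors.mpr ⟨hp, hpm, by omega⟩)
    exact absurd this (by have := hp.pos; omega)
  | succ P ih =>
    by_cases hP : (P + 1).Prime
    · have hcard : (Nat.primesLE (P + 1)).card = (Nat.primesLE P).card + 1 := by
        have : Nat.primesLE (P + 1) = insert (P + 1) (Nat.primesLE P) := by
          ext q
          simp only [Nat.mem_primesLE, Finset.mem_insert]
          constructor
          · rintro ⟨h1, h2⟩
            rcases Nat.lt_or_ge q (P + 1) with h | h
            · exact Or.inr ⟨by omega, h2⟩
            · exact Or.inl (by omega)
          · rintro (rfl | ⟨h1, h2⟩)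
            · exact ⟨le_rfl, hP⟩
            · exact ⟨by omega, h2⟩
        rw [this, Finset.card_insert_of_notMem]
        rw [Nat.mem_primesLE]
        omega
      rw [hcard, pow_succ]
      -- `m ↦ (m / (P+1)^{v(m)}, v(m))` is injective into `{(P)-smooth} × range`
      set S := (Icc 1 N).filter fun m : ℕ => ∀ p ∈ m.primeFactors, p ≤ P with hS
      set T := (Icc 1 N).filter fun m : ℕ => ∀ p ∈ m.primeFactors, p ≤ P + 1 with hT
      have himg : T ⊆ (S ×ˢ Finset.range (Nat.log 2 N + 1)).image fun x => x.1 * (P + 1) ^ x.2 := by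
        intro m hm
        rw [hT, Finset.mem_filter, Finset.mem_Icc] at hm
        obtain ⟨⟨hm1, hmN⟩, hmP⟩ := hm
        have hm0 : m ≠ 0 := by omega
        set a := m.factorization (P + 1) with ha
        have hdvd : (P + 1) ^ a ∣ m := Nat.ordProj_dvd m (P + 1)
        obtain ⟨m', hm'⟩ := hdvd
        have hm'0 : m' ≠ 0 := fun h => hm0 (by rw [hm', h, mul_zero])
        refine Finset.mem_image.mpr ⟨(m', a), Finset.mem_product.mpr ⟨?_, ?_⟩, by rw [hm', mul_comm]⟩
        · rw [hS, Finset.mem_filter, Finset.mem_Icc]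
          refine ⟨⟨Nat.one_le_iff_ne_zero.mpr hm'0, le_trans (Nat.le_of_dvd (by omega) ⟨(P+1)^a, by
            rw [hm', mul_comm]⟩) hmN⟩, fun p hp => ?_⟩
          have hp' := Nat.prime_of_mem_primeFactors hp
          have hpm : p ∈ m.primeFactors := by
            rw [hm']
            exact Nat.mem_primeFactors.mpr ⟨hp', (Nat.dvd_of_mem_primeFactors hp).mul_left _,
              mul_ne_zero (pow_ne_zero _ hP.ne_zero) hm'0⟩
          have h1 := hmP p hpm
          rcases Nat.lt_or_ge p (P + 1) with h | h
          · omega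
          · exfalso
            have hpe : p = P + 1 := by omega
            subst hpe
            -- `P+1 ∣ m'` contradicts the maximality of `a`
            have h2 : (P + 1) ^ (a + 1) ∣ m := by
              rw [hm', pow_succ]
              exact mul_dvd_mul_left _ (Nat.dvd_of_mem_primeFactors hp)
            have := (hP.pow_dvd_iff_le_factorization hm0).mp h2
            omega
        · rw [Finset.mem_range, Nat.lt_succ_iff]
          have h1 : (P + 1) ^ a ≤ N := le_trans (Nat.le_of_dvd (by omega) (Nat.ordProj_dvd m (P + 1))) hmN
          calc a ≤ Nat.log (P + 1) N := Nat.le_log_of_pow_le hP.one_lt h1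
            _ ≤ Nat.log 2 N := Nat.log_anti_left (by norm_num) hP.two_le
      calc #T ≤ #((S ×ˢ Finset.range (Nat.log 2 N + 1)).image fun x => x.1 * (P + 1) ^ x.2) :=
            Finset.card_le_card himg
        _ ≤ #(S ×ˢ Finset.range (Nat.log 2 N + 1)) := Finset.card_image_le
        _ = #S * (Nat.log 2 N + 1) := by rw [Finset.card_product, Finset.card_range]
        _ ≤ (Nat.log 2 N + 1) ^ (Nat.primesLE P).card * (Nat.log 2 N + 1) := Nat.mul_le_mul_right _ ih
    · have hcard : Nat.primesLE (P + 1) = Nat.primesLE P := by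
        ext q
        simp only [Nat.mem_primesLE]
        constructor
        · rintro ⟨h1, h2⟩
          exact ⟨by by_contra h; exact hP (by rwa [show q = P + 1 by omega] at h2), h2⟩
        · rintro ⟨h1, h2⟩
          exact ⟨by omega, h2⟩
      have hset : ((Icc 1 N).filter fun m : ℕ => ∀ p ∈ m.primeFactors, p ≤ P + 1) =
          (Icc 1 N).filter fun m : ℕ => ∀ p ∈ m.primeFactors, p ≤ P := by
        refine Finset.filter_congr fun m _ => ⟨fun h p hp => ?_, fun h p hp => (h p hp).trans (Nat.le_succ P)⟩
        have h1 := h p hp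
        have : p ≠ P + 1 := fun he => hP (he ▸ Nat.prime_of_mem_primeFactors hp)
        omega
      rw [hcard, hset]
      exact ih

/-! ### The smooth part of the product value is the `S`-part of Bugeaud–Evertse–Győry -/

/-- The smooth part over a product of non-zero naturals. [folklore] -/
theorem smoothPart_finset_prod (z : ℝ) {ι : Type*} (S : Finset ι) (g : ι → ℕ) (hg : ∀ i ∈ S, g i ≠ 0) :
    smoothPart z (∏ i ∈ S, g i) = ∏ i ∈ S, smoothPart z (g i) := by
  induction S using Finset.induction_on with
  | empty => simp
  | insert a S ha ih =>
    rw [Finset.prod_insert ha, Finset.prod_insert ha,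
      smoothPart_mul z (hg a (Finset.mem_insert_self a S))
        (Finset.prod_ne_zero_iff.mpr fun i hi => hg i (Finset.mem_insert_of_mem hi)),
      ih fun i hi => hg i (Finset.mem_insert_of_mem hi)]

/-- `smoothPart P m = ∏_{p ≤ P} p^{v_p(m)}` — the `S`-part of `m` for `S` the primes `≤ P`. [folklore] -/
theorem smoothPart_eq_sPart (P m : ℕ) : smoothPart (P : ℝ) m = sPart (Nat.primesLE P) (m : ℤ) := by
  unfold sPart
  refine Nat.eq_of_factorization_eq (smoothPart_ne_zero _ _)
    (Finset.prod_ne_zero_iff.mpr fun p hp => pow_ne_zero _ (Nat.prime_of_mem_primesLE hp).ne_zero) fun q => ?_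
  rw [factorization_smoothPart, Nat.factorization_prod fun p hp => pow_ne_zero _ (Nat.prime_of_mem_primesLE hp).ne_zero,
    Finsupp.finsetSum_apply]
  simp only [padicValInt.of_nat]
  rw [Finset.sum_congr rfl fun p hp => by rw [(Nat.prime_of_mem_primesLE hp).factorization_pow]]
  by_cases hq : q.Prime
  · by_cases hqP : (q : ℝ) ≤ P
    · rw [if_pos hqP, Finset.sum_eq_single q]
      · rw [Finsupp.single_eq_same, Nat.factorization_def _ hq]
      · intro p _ hpq
        rw [Finsupp.single_eq_of_ne hpq.symm]
      · intro h
        exact absurd (Nat.mem_primesLE.mpr ⟨by exact_mod_cast hqP, hq⟩) h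
    · rw [if_neg hqP, Finset.sum_eq_zero]
      intro p hp
      rw [Finsupp.single_eq_of_ne]
      rintro rfl
      exact hqP (by exact_mod_cast (Nat.mem_primesLE.mp hp).1)
  · rw [Nat.factorization_eq_zero_of_not_prime _ hq, Finset.sum_eq_zero]
    · simp
    · intro p hp
      rw [Finsupp.single_eq_of_ne]
      rintro rfl
      exact hq (Nat.prime_of_mem_primesLE hp)

/-- The product of a Bateman–Horn system is separable over `ℚ`. [folklore] -/
theorem separable_map_prod {f : Fin k → ℤ[X]} (hf : IsBatemanHornSystem f) :
    ((∏ i, f i).map (Int.castRingHom ℚ)).Separable := by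
  obtain ⟨A, B, R, hR, hAB⟩ := exists_prod_mul_add_derivative_mul_eq_C hf
  set φ := Int.castRingHom ℚ
  have hR' : (R : ℚ) ≠ 0 := by exact_mod_cast hR
  have h := congr_arg (Polynomial.map φ) hAB
  simp only [Polynomial.map_add, Polynomial.map_mul] at h
  refine ⟨A.map φ * C ((R : ℚ)⁻¹), B.map φ * C ((R : ℚ)⁻¹), ?_⟩
  calc A.map φ * C ((R : ℚ)⁻¹) * (∏ i, f i).map φ + B.map φ * C ((R : ℚ)⁻¹) * derivative ((∏ i, f i).map φ)
      = ((∏ i, f i).map φ * A.map φ + (derivative (∏ i, f i)).map φ * B.map φ) * C ((R : ℚ)⁻¹) := by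
        rw [Polynomial.derivative_map]
        ring
    _ = 1 := by
        rw [h, Polynomial.map_C]
        simp only [eq_intCast]
        rw [← C_mul, mul_inv_cancel₀ hR', C_1]

/-- **tailsTwo_smoothPart_prodVal_le** (registered helper of `stub_tailsTwo`, line `product-anatomy-subcritical`;
CONDITIONAL on the named fact (R) `BugeaudEvertseGyory2018_SPartPolynomialValues`): along a Bateman–Horn system of
total degree `2` the product of the `P`-smooth parts of the values — the `S`-part of `∏ fᵢ(n)`, `S` the primes
`≤ P` — is `≤ C · max(1,n)^{1+2ε}` (Bugeaud–Evertse–Győry Thm 2.1 (i): `∏ fᵢ` has degree `2` and no multiple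
zeros). [folklore] -/
theorem tailsTwo_smoothPart_prodVal_le : BugeaudEvertseGyory2018_SPartPolynomialValues →
    ∀ (k : ℕ) (f : Fin k → ℤ[X]), IsBatemanHornSystem f → (∑ i, (f i).natDegree) = 2 → ∀ (P : ℕ) (ε : ℝ), 0 < ε →
    ∃ C : ℝ, 0 < C ∧ ∀ n : ℕ, (∀ i, (1 : ℤ) ≤ (f i).eval (n : ℤ)) →
      (∏ i, (smoothPart (P : ℝ) (val f i n) : ℝ)) ≤ C * (max 1 (n : ℝ)) ^ (1 + 2 * ε) := by
  intro hBEG k f hf hdeg P ε hε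
  have hf0 : ∀ i, f i ≠ 0 := fun i => (hf.irreducible i).ne_zero
  have hF : (∏ i, f i).natDegree = 2 := by rw [natDegree_prod _ _ fun i _ => hf0 i, hdeg]
  obtain ⟨C, hC, hb⟩ := hBEG.le_pow_max (∏ i, f i) (by rw [hF]) (separable_map_prod hf) (Nat.primesLE P)
    (fun p hp => Nat.prime_of_mem_primesLE hp) hε
  refine ⟨C, hC, fun n hn => ?_⟩
  have hval : ∀ i, (val f i n : ℤ) = (f i).eval (n : ℤ) := fun i => by
    rw [val_eq_natAbs hn i, Int.natAbs_of_nonneg (by have := hn i; omega)]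
  have hprod : (∏ i, f i).eval (n : ℤ) = ((∏ i, val f i n : ℕ) : ℤ) := by
    rw [eval_prod, Nat.cast_prod]
    exact Finset.prod_congr rfl fun i _ => (hval i).symm
  have hne : (∏ i, f i).eval (n : ℤ) ≠ 0 := by
    rw [eval_prod]
    exact Finset.prod_ne_zero_iff.mpr fun i _ => by have := hn i; omega
  have h := hb (n : ℤ) hne
  rw [hF, hprod, ← smoothPart_eq_sPart, smoothPart_finset_prod _ _ _ fun i _ => by rw [val]; positivity] at h
  push_cast at h
  simpa [abs_of_nonneg (Nat.cast_nonneg (α := ℝ) n)] using h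

/-! ### Sizes of values and a polylogarithm -/

/-- Values of the members at `1 ≤ n ≤ N` are at most `H_f · N²` (total degree `2`). [folklore] -/
theorem val_le_of_sum_natDegree {f : Fin k → ℤ[X]} (hdeg : (∑ i, (f i).natDegree) = 2) :
    ∃ Hv : ℕ, 1 ≤ Hv ∧ ∀ (i : Fin k) (n N : ℕ), 1 ≤ n → n ≤ N → val f i n ≤ Hv * N ^ 2 := by
  set Hv : ℕ := 1 + ∑ i, ∑ j ∈ Finset.range ((f i).natDegree + 1), ((f i).coeff j).natAbs with hHv
  refine ⟨Hv, by omega, fun i n N hn hnN => ?_⟩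
  have hdi : (f i).natDegree ≤ 2 := by
    rw [← hdeg]
    exact Finset.single_le_sum (f := fun j => (f j).natDegree) (fun j _ => Nat.zero_le _) (Finset.mem_univ i)
  have h := abs_eval_le_height_mul_pow (f i) (n : ℤ)
  have hmax : max 1 |((n : ℤ) : ℝ)| = n := by
    rw [Int.cast_natCast, abs_of_nonneg (Nat.cast_nonneg n), max_eq_right (by exact_mod_cast hn)]
  rw [hmax] at h
  have hHi : (∑ j ∈ Finset.range ((f i).natDegree + 1), |((f i).coeff j : ℝ)|) ≤ Hv := by
    rw [hHv]
    push_cast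
    have : (∑ j ∈ Finset.range ((f i).natDegree + 1), |((f i).coeff j : ℝ)|) =
        ∑ j ∈ Finset.range ((f i).natDegree + 1), ((((f i).coeff j).natAbs : ℕ) : ℝ) :=
      Finset.sum_congr rfl fun j _ => by rw [Nat.cast_natAbs, Int.cast_abs]
    rw [this]
    have h0 : ∀ i', 0 ≤ ∑ j ∈ Finset.range ((f i').natDegree + 1), ((((f i').coeff j).natAbs : ℕ) : ℝ) :=
      fun i' => Finset.sum_nonneg fun j _ => Nat.cast_nonneg _
    linarith [Finset.single_le_sum (fun i' _ => h0 i') (Finset.mem_univ i)]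
  have hpow : (n : ℝ) ^ (f i).natDegree ≤ (N : ℝ) ^ 2 := by
    calc (n : ℝ) ^ (f i).natDegree ≤ (N : ℝ) ^ (f i).natDegree :=
          pow_le_pow_left₀ (Nat.cast_nonneg n) (by exact_mod_cast hnN) _
      _ ≤ (N : ℝ) ^ 2 := pow_le_pow_right₀ (by exact_mod_cast (hn.trans hnN)) hdi
  rcases le_or_gt 1 ((f i).eval (n : ℤ)).toNat with h1 | h1
  · have hv : (val f i n : ℝ) ≤ |(((f i).eval (n : ℤ) : ℤ) : ℝ)| := by
      rw [val, max_eq_left h1]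
      have : (((f i).eval (n : ℤ)).toNat : ℤ) ≤ |(f i).eval (n : ℤ)| := by
        rw [Int.toNat_of_nonneg (by omega)]
        exact le_abs_self _
      exact_mod_cast this
    have : (val f i n : ℝ) ≤ Hv * (N : ℝ) ^ 2 :=
      hv.trans (h.trans (mul_le_mul hHi hpow (by positivity) (by positivity)))
    exact_mod_cast this
  · rw [val, max_eq_right (by omega)]
    have hN : 1 ≤ N ^ 2 := Nat.one_le_pow _ _ (by omega)
    calc 1 = 1 * 1 := rfl
      _ ≤ Hv * N ^ 2 := Nat.mul_le_mul (by omega) hN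

end

end Summit.Parity.BatemanHorn.Cruxes.LSDRealSegment.ProductAnatomySubcritical
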